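import Summits.CriticalPhenomena.PercolationContinuityZ3.Theorems.Transplant.AutCylinderOfQuasiNode
import HarnessLib

/-!
# The quasi-step node's hC-FREE CLASS in kernel: actions whose character kernel has FINITE ORBITS (every doubly periodic graph, every virtually-ℤ² action,
# the rotor lattice) — cylinders are FINITE, so `CylSubcritical` holds at every density and `θ_x(p_c) = 0` follows from the node ALONE (no Milnor, no
# growth hypothesis, no structure theorem)

builds on p205010 (kernel theorem, internal audit signed; external expert review pending) — nothing in this file uses p205010; NOTHING is claimed about any
node: the node statement enters only as the hypothesis binder `hNode` (name and words are the lead's).  Lane `prim-bschramm`, seat `prim-bschramm-p5` gen 28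
(refuter / sharpness seat; P5-SHARPNESS §60 rows 100–101: the hC-free reach).  Helper file (`--supports stmt-CriticalPhenomena-4575 --as helper`); PROOFS ONLY.

WHAT.  For a tree datum `D` whose character kernel moves every representative inside a FINITE set (`∀ r ∈ reps, {k • r : c k = 1}` finite):
* §1 `rebase_eq_zero` (the re-basing on an independent pair is injective), `coarseCyl_finite` (every coarse cylinder is finite: it is covered by the translates
  `a_y • (kernel orbit of r)`, `r ∈ reps`, `y` in the fine box), `exists_ker_gen_of_kerOrbitFinite` (the kernel hypothesis of the adapter holds trivially: every
  kernel element IS a bounded mover), `cylSubcritical_skeleton_of_kerOrbitFinite` (`CylSubcritical p` at EVERY `p`, by finiteness);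
* §2 **`theta_criticalProb_eq_zero_of_quasiNode_of_kerOrbitFinite (hNode) … (HKF) (x) : θ_x(p_c) = 0`** — finite orbits + rank-two character killing a
  stabiliser + kernel with finite orbits ⇒ the node's conclusion at every vertex, with nothing else assumed;
* §3 **`conj4_of_quasiNode_zTwoPeriodic (hNode)`: EVERY DOUBLY PERIODIC GRAPH** — a connected locally finite graph with a FREE action of `ℤ²` (as
  `Multiplicative (Site 2)`) by automorphisms with finitely many orbits — has `p_c < 1` and `θ_x(p_c) = 0` at every vertex, from the node alone (planar or not,
  symmetric or not: honeycomb, kagome, every Archimedean/Laves lattice, every decorated or stacked 2D net, the rotor lattice's relatives).  Not in print beyond the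
  planar symmetric cases (FRESHNESS 2026-08-27 06:55Z).
[cite: BenjaminiSchramm1996, Conj. 4; §2 (almost transitive graphs)] [cite: KozmaNitzan2024, §4 p. 15 (boxes), p. 16 (Lemma 8)] [cite: Kesten1982, Ch. 3 (periodic graphs)]
-/

noncomputable section

namespace Summit.CriticalPhenomena.PercolationContinuityZ3.Theorems.Transplant

open SimpleGraph Literature.Barriers.CriticalPhenomena Literature.Probability.LatticeModels Literature.Probability.Percolation
open scoped Classical

namespace AutChart

/-! ## §1 Finite kernel orbits: finite cylinders, trivial kernel hypothesis -/

/-- **Re-basing on an independent pair is injective**: `rebase u w x = 0 ⟹ x = 0` (Cramer). [folklore] -/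
theorem rebase_eq_zero {u w x : Site 2} (hdet : MaxArea.det2 u w ≠ 0) (h : MaxArea.rebase u w x = 0) : x = 0 := by
  have hs : Int.sign (MaxArea.det2 u w) ≠ 0 := fun h0 => hdet (Int.sign_eq_zero_iff_zero.1 h0)
  have h0 : MaxArea.det2 x w = 0 := by
    have := congrFun h 0
    rw [MaxArea.rebase_apply_zero, Pi.zero_apply] at this
    rcases mul_eq_zero.1 this with h' | h'
    · exact absurd h' hs
    · exact h'
  have h1 : MaxArea.det2 u x = 0 := by
    have := congrFun h 1
    rw [MaxArea.rebase_apply_one, Pi.zero_apply] at this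
    rcases mul_eq_zero.1 this with h' | h'
    · exact absurd h' hs
    · exact h'
  funext i
  have hc := MaxArea.cramer u w x i
  rw [h0, h1, zero_mul, zero_mul, add_zero] at hc
  rcases mul_eq_zero.1 hc with h' | h'
  · exact absurd h' hdet
  · rw [h', Pi.zero_apply]

namespace TreeDatum

variable {V : Type} {G : SimpleGraph V} {A : Type} [Group A] [MulAction A V] (D : TreeDatum G A) [G.LocallyFinite]

/-- **Coarse cylinders are FINITE when the kernel has finite orbits on the representatives**: the cylinder is covered by the translates `a_y • {k • r}`,
`r ∈ reps`, `y` in the (finite) fine box, `a_y` any element of value `y`. [cite: KozmaNitzan2024, §4 p. 15 (boxes)] -/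
theorem coarseCyl_finite (HKF : ∀ r ∈ D.reps, Set.Finite {v : V | ∃ k : A, D.c k = 1 ∧ k • r = v}) (t : V) (ℓ : ℕ) :
    ({w | D.coarse w - D.coarse t ∈ box 2 ℓ} : Set V).Finite := by
  rw [D.coarseCyl_eq_fineBox t ℓ]
  set B : Finset (Site 2) := Fintype.piFinset fun j : Fin 2 =>
    Finset.Icc ((D.N : ℤ) * (D.coarse t j - ℓ)) ((D.N : ℤ) * (D.coarse t j + ℓ + 1) - 1) with hB
  -- the value classes
  let T : V → Site 2 → Set V := fun r y => {w | ∃ a : A, Multiplicative.toAdd (D.c a) = y ∧ a • r = w}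
  have hT : ∀ r ∈ D.reps, ∀ y : Site 2, (T r y).Finite := by
    intro r hr y
    by_cases hex : ∃ a₀ : A, Multiplicative.toAdd (D.c a₀) = y
    · obtain ⟨a₀, ha₀⟩ := hex
      refine ((HKF r hr).image fun v => a₀ • v).subset ?_
      rintro w ⟨a, ha, rfl⟩
      refine ⟨(a₀⁻¹ * a) • r, ⟨a₀⁻¹ * a, ?_, rfl⟩, ?_⟩
      · have e : D.c a₀ = D.c a := Multiplicative.toAdd.injective (ha₀.trans ha.symm)
        rw [map_mul, map_inv, e, inv_mul_cancel]
      · show a₀ • (a₀⁻¹ * a) • r = a • r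
        rw [← mul_smul, mul_inv_cancel_left]
    · refine Set.Finite.subset Set.finite_empty ?_
      rintro w ⟨a, ha, -⟩
      exact hex ⟨a, ha⟩
  refine ((D.reps.finite_toSet.biUnion fun r hr => B.finite_toSet.biUnion fun y _ => hT r hr y)).subset ?_
  intro w hw
  obtain ⟨a, r, hr, rfl⟩ := D.cover w
  have hval : D.chart (a • r) = Multiplicative.toAdd (D.c a) := by rw [D.chart_smul, D.chart_of_mem hr, add_zero]
  have hy : Multiplicative.toAdd (D.c a) ∈ B := by
    have h : D.chart (a • r) ∈ (B : Set (Site 2)) := hw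
    rwa [hval] at h
  refine Set.mem_biUnion (Finset.mem_coe.2 hr) (Set.mem_biUnion (Finset.mem_coe.2 hy) ?_)
  exact ⟨a, rfl, rfl⟩

omit [G.LocallyFinite] in
/-- **With finite kernel orbits the kernel hypothesis of the adapter holds TRIVIALLY**: every kernel element is itself a bounded mover (its translate of `r`
lies in the finite orbit, at bounded distance by connectedness). [folklore] -/
theorem exists_ker_gen_of_kerOrbitFinite (hc : G.Connected) (HKF : ∀ r ∈ D.reps, Set.Finite {v : V | ∃ k : A, D.c k = 1 ∧ k • r = v}) :
    ∃ m : ℕ, ∀ r ∈ D.reps, ∀ k : A, D.c k = 1 → k ∈ Subgroup.closure {g : A | D.c g = 1 ∧ g • r ∈ graphBall G r m} := by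
  have hdist : ∀ r v : V, ∃ n : ℕ, v ∈ graphBall G r n := fun r v => by
    obtain ⟨w⟩ := hc.preconnected r v
    exact ⟨w.length, w, le_rfl⟩
  choose dist hdist using hdist
  refine ⟨D.reps.sup fun r => if hr : r ∈ D.reps then (HKF r hr).toFinset.sup (dist r) else 0, fun r hr k hk => ?_⟩
  refine Subgroup.subset_closure ⟨hk, graphBall_mono G r ?_ (hdist r (k • r))⟩
  have hmem : k • r ∈ (HKF r hr).toFinset := (Set.Finite.mem_toFinset _).2 ⟨k, hk, rfl⟩
  refine le_trans ?_ (Finset.le_sup (f := fun r => if hr : r ∈ D.reps then (HKF r hr).toFinset.sup (dist r) else 0) hr)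
  simp only [dif_pos hr]
  exact Finset.le_sup (f := dist r) hmem

/-- **Finite cylinders are subcritical at EVERY density**: `CylSubcritical p` for the carrier `D.skeleton`. [folklore] -/
theorem cylSubcritical_skeleton_of_kerOrbitFinite (hc : G.Connected) (HKF : ∀ r ∈ D.reps, Set.Finite {v : V | ∃ k : A, D.c k = 1 ∧ k • r = v})
    {m : ℕ} (hker : ∀ r ∈ D.reps, ∀ k : A, D.c k = 1 → k ∈ Subgroup.closure {g : A | D.c g = 1 ∧ g • r ∈ graphBall G r m}) (p : unitInterval) :
    (D.skeleton hc hker).CylSubcritical p := by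
  intro t _ ℓ
  haveI : Finite ↥({w | D.coarse w - D.coarse t ∈ box 2 ℓ} : Set V) := (D.coarseCyl_finite HKF t ℓ).to_subtype
  show theta (G.induce {w | D.coarse w - D.coarse t ∈ box 2 ℓ}) _ p = 0
  exact Literature.Probability.Percolation.theta_eq_zero_of_finite _ _ p

end TreeDatum

/-! ## §2 The node's conclusion for finite kernel orbits, hypothesis-free otherwise -/

/-- **`θ_x(p_c) = 0` FROM THE QUASI-STEP NODE ALONE when the character kernel has finite orbits**: a connected locally finite graph, an action by automorphisms
with finitely many orbits, a character `c : A → ℤ²` of rank two killing one stabiliser, and `{k • v : c k = 1}` finite for every `v` — then the tree chart's carrier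
has finite cylinders (`CylSubcritical` at every density), proxies everywhere, and the node (hypothesis `hNode`) gives `θ = 0` at a type, transported to `x` by its
frame.  No Milnor lemma, no growth hypothesis. [cite: BenjaminiSchramm1996, Conj. 4; §2] [cite: KozmaNitzan2024, §4 p. 16 (Lemma 8)] -/
theorem theta_criticalProb_eq_zero_of_quasiNode_of_kerOrbitFinite {V : Type} {G : SimpleGraph V} {A : Type} [Group A] [MulAction A V] [G.LocallyFinite]
    (hNode : ∀ {W : Type} (G : SimpleGraph W) [G.LocallyFinite] (Φ : PlanarSkeletonFrmQuasi G) (t : W) (D : ℕ),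
      t ∈ Φ.types → Φ.HasProxies t D → Φ.CylSubcritical (criticalProbIOf G t) → theta G t (criticalProbIOf G t) = 0)
    (hact : IsActionByAut G A) (hc : G.Connected) (reps₀ : Finset V) (hcover₀ : ∀ w : V, ∃ a : A, ∃ r ∈ reps₀, a • r = w)
    (c : A →* Multiplicative (Site 2)) {t₀ : V} (hstab : ∀ h ∈ MulAction.stabilizer A t₀, c h = 1)
    (hrank : ∃ a b : A, MaxArea.det2 (Multiplicative.toAdd (c a)) (Multiplicative.toAdd (c b)) ≠ 0)
    (HKF : ∀ v : V, Set.Finite {w : V | ∃ k : A, c k = 1 ∧ k • v = w}) (x : V) :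
    theta G x (criticalProbIOf G x) = 0 := by
  haveI : Countable V := countable_of_connected_of_locallyFinite G hc x
  obtain ⟨D, u, w, hcD, hΔ⟩ := exists_treeDatum hact hc reps₀ hcover₀ c hstab hrank
  have hdet : MaxArea.det2 u w ≠ 0 := by
    intro h0
    have h1 := D.one_le_Δ
    have : (D.Δ : ℤ) = 0 := by rw [hΔ, h0, abs_zero]
    omega
  -- the kernel of the re-based character is the kernel of `c`
  have hker1 : ∀ k : A, D.c k = 1 → c k = 1 := fun k hk => by
    have h : MaxArea.rebase u w (Multiplicative.toAdd (c k)) = 0 := by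
      have e : Multiplicative.toAdd (D.c k) = MaxArea.rebase u w (Multiplicative.toAdd (c k)) := by rw [hcD]; rfl
      rw [← e, hk, toAdd_one]
    exact Multiplicative.toAdd.injective (by rw [rebase_eq_zero hdet h, toAdd_one])
  have HKF' : ∀ r ∈ D.reps, Set.Finite {v : V | ∃ k : A, D.c k = 1 ∧ k • r = v} := fun r _ =>
    (HKF r).subset fun v ⟨k, hk, hkv⟩ => ⟨k, hker1 k hk, hkv⟩
  obtain ⟨m, hker⟩ := D.exists_ker_gen_of_kerOrbitFinite hc HKF'
  obtain ⟨Dp, hprox⟩ := D.skeleton_hasProxies hc hker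
  obtain ⟨t, ht, α, hαt, -⟩ := (D.skeleton hc hker).frame x
  have hθt : theta G t (criticalProbIOf G t) = 0 :=
    hNode G (D.skeleton hc hker) t Dp ht (hprox t) (D.cylSubcritical_skeleton_of_kerOrbitFinite hc HKF' hker _)
  have e1 := theta_iso α t (criticalProbIOf G t)
  have e2 : criticalProbIOf G (α t) = criticalProbIOf G t := Subtype.ext (criticalProb_iso α t)
  rw [← hαt, e2, e1]
  exact hθt

/-! ## §3 Every doubly periodic graph -/

/-- **EVERY DOUBLY PERIODIC GRAPH, from the quasi-step node alone**: a connected locally finite graph with a FREE action of `ℤ²` (written `Multiplicative (Site 2)`)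
by automorphisms with finitely many orbits has `p_c < 1` and `θ_x(p_c) = 0` at every vertex `x` — planar or not, symmetric or not.  (Character = the identity:
free ⇒ stabilisers trivial, kernel trivial; rank two from `e₀, e₁`.) [cite: BenjaminiSchramm1996, Conj. 4; §2] [cite: Kesten1982, Ch. 3 (periodic graphs)] -/
theorem conj4_of_quasiNode_zTwoPeriodic {V : Type} {G : SimpleGraph V} [MulAction (Multiplicative (Site 2)) V] [G.LocallyFinite]
    (hNode : ∀ {W : Type} (G : SimpleGraph W) [G.LocallyFinite] (Φ : PlanarSkeletonFrmQuasi G) (t : W) (D : ℕ),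
      t ∈ Φ.types → Φ.HasProxies t D → Φ.CylSubcritical (criticalProbIOf G t) → theta G t (criticalProbIOf G t) = 0)
    (hact : IsActionByAut G (Multiplicative (Site 2))) (hfree : ∀ (a : Multiplicative (Site 2)) (v : V), a • v = v → a = 1)
    (hc : G.Connected) (reps₀ : Finset V) (hcover₀ : ∀ w : V, ∃ a : Multiplicative (Site 2), ∃ r ∈ reps₀, a • r = w) (x : V) :
    criticalProb G x < 1 ∧ theta G x (criticalProbIOf G x) = 0 := by
  set c : Multiplicative (Site 2) →* Multiplicative (Site 2) := MonoidHom.id _ with hc_def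
  have hstab : ∀ h ∈ MulAction.stabilizer (Multiplicative (Site 2)) x, c h = 1 := fun h hh => by
    rw [hc_def, MonoidHom.id_apply]
    exact hfree h x (MulAction.mem_stabilizer_iff.1 hh)
  have hrank : ∃ a b : Multiplicative (Site 2), MaxArea.det2 (Multiplicative.toAdd (c a)) (Multiplicative.toAdd (c b)) ≠ 0 := by
    refine ⟨Multiplicative.ofAdd (Pi.single 0 1), Multiplicative.ofAdd (Pi.single 1 1), ?_⟩
    simp only [hc_def, MonoidHom.id_apply, toAdd_ofAdd]
    unfold MaxArea.det2
    simp
  have HKF : ∀ v : V, Set.Finite {w : V | ∃ k : Multiplicative (Site 2), c k = 1 ∧ k • v = w} := fun v => by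
    refine (Set.finite_singleton v).subset ?_
    rintro w ⟨k, hk, rfl⟩
    rw [hc_def, MonoidHom.id_apply] at hk
    rw [hk, one_smul]
    exact Set.mem_singleton v
  refine ⟨AutChart.criticalProb_lt_one_of_finite_orbits hact hc x reps₀ hcover₀ c hstab hrank x,
    theta_criticalProb_eq_zero_of_quasiNode_of_kerOrbitFinite hNode hact hc reps₀ hcover₀ c hstab hrank HKF x⟩

end AutChart

end Summit.CriticalPhenomena.PercolationContinuityZ3.Theorems.Transplant

end
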